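import Summits.HubbardSuperconductivity.HubbardSuperconductivity.Theorems.AnisotropyChordTransferFibre3FinXDCheck

/-!
# Route `AnisotropyChord` / H0 rotor rung: FIN per-`L` row-D (KT-2a″) SUB-CELL facts, `L = 9` (96–101)

Row-D facts `xdCellAny0 9 (49/50) la lb aD = true` on quarter sub-cells of the combined cells whose side condition needs `aD ≈ .04` (mechhunt STATUS p3 g7 REPORT 3).
Prover seat `hubbard-h0-rotor-p3` g7; helper for piece A = stmt-HubbardSuperconductivity-23918 of rung 19089 (`--supports`, helper class).
WHAT THIS IS NOT: nothing here proves superconductivity in the Hubbard model (rotor TARGET as worded stays FALSE, g15 verdict); kernel facts /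
assembly for ONE conditional reduction at one `L`.  No sorry.
-/

set_option linter.dupNamespace false
set_option autoImplicit false

namespace Summit.HubbardSuperconductivity.HubbardSuperconductivity.Theorems.AnisotropyChord.Transfer.Fibre3

namespace FinXD

/-- row-D sub-cell `[19454363742296065, 19575953515685415]` of `L = 9`. [folklore] -/
theorem xd9s_135_0 : xdCellAny0 9 (49/50 : ℚ) 19454363742296065 19575953515685415 (1/25 : ℚ) = true := by decide +kernel

/-- row-D sub-cell `[19575953515685415, 19697543289074765]` of `L = 9`. [folklore] -/
theorem xd9s_135_1 : xdCellAny0 9 (49/50 : ℚ) 19575953515685415 19697543289074765 (1/25 : ℚ) = true := by decide +kernel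

/-- row-D sub-cell `[19697543289074765, 19819133062464115]` of `L = 9`. [folklore] -/
theorem xd9s_135_2 : xdCellAny0 9 (49/50 : ℚ) 19697543289074765 19819133062464115 (1/25 : ℚ) = true := by decide +kernel

/-- row-D sub-cell `[19819133062464115, 19940722835853465]` of `L = 9`. [folklore] -/
theorem xd9s_135_3 : xdCellAny0 9 (49/50 : ℚ) 19819133062464115 19940722835853465 (1/25 : ℚ) = true := by decide +kernel

/-- row-D sub-cell `[19940722835853465, 20065352353577549]` of `L = 9`. [folklore] -/
theorem xd9s_136_0 : xdCellAny0 9 (49/50 : ℚ) 19940722835853465 20065352353577549 (1/25 : ℚ) = true := by decide +kernel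

/-- row-D sub-cell `[20065352353577549, 20189981871301633]` of `L = 9`. [folklore] -/
theorem xd9s_136_1 : xdCellAny0 9 (49/50 : ℚ) 20065352353577549 20189981871301633 (1/25 : ℚ) = true := by decide +kernel

end FinXD

end Summit.HubbardSuperconductivity.HubbardSuperconductivity.Theorems.AnisotropyChord.Transfer.Fibre3
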